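import Mathlib
import HarnessLib
import Summits.Langlands.Langlands.Statement
import Summits.Langlands.Langlands.Theorems.IrreducibilityBySelfDualityIrreducibleOffSectorTransfer
import Summits.Langlands.Langlands.Theorems.PicardMuOrdinaryMuOrdinaryFamilyRTQuadraticDescentClifford
import Literature.NumberTheory.Automorphic.QuadraticCharacterTwist
import Literature.NumberTheory.Automorphic.QuadraticBaseChangeFrobCompatibleProofs
import Literature.NumberTheory.Automorphic.AutomorphicTwistWeightOne
import Literature.NumberTheory.GaloisRepresentations.ArtinCharacterReciprocityProofs
import Literature.NumberTheory.GaloisRepresentations.TateTwistFrobeniusProofs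
import Literature.NumberTheory.GaloisRepresentations.FramedRepTwist

/-!
# `ReciprocityTRCM` (route BaseFieldAscent, crux stmt-Langlands-1093), line `pieces`:
# registered stub `stub_twistMatchingOfQuadraticDescent` (5A2) — twist matching after
# quadratic descent

Stub 5A2 of the lead's reshape of stub 5 (weak (B) over a totally real `F` from reciprocity over
CM fields, given (A) over `F`).  Setting: `E/F` quadratic, `R` reciprocity data over `F` carrying
direction (A) in rank `n` (`AutomorphicToGalois n R hF`), `ρ : Γ_F → GL_n(ℚ̄_ℓ)` with `ρ|_{Γ_E}`
irreducible, a cuspidal `P` on `GL_n(𝔸_E)` Satake–Frobenius compatible with `ρ|_{Γ_E}` almost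
everywhere, and an L-algebraic cuspidal `π₁` on `GL_n(𝔸_F)` of which `P` is a weak base change
(`IsWeakBaseChangeLiftAE`, the output of stub 5A1).  Conclusion: some L-algebraic cuspidal `π` on
`GL_n(𝔸_F)` is Satake–Frobenius compatible with `ρ` itself almost everywhere.

Printed argument (Barnet-Lamb–Gee–Geraghty–Taylor §5 / Taylor; Arthur–Clozel Ch. 3, proof of
Thm. 3.1, p. 172), and the tree theorems assembling it — everything below is PROVED, no named
fact is consumed as a hypothesis:

1. (A) over `F` gives `ρ₁ = ρ_{π₁,ι}` with `Corresponds R ι π₁ ρ₁`; `ρ₁|_{Γ_E}` is a.e. compatible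
   with `P` (`eventually_satakeFrobCompatible_restrictField_of_isWeakBaseChangeLiftAE`, `m = 1`),
   as is `ρ|_{Γ_E}`, irreducible; hence `ρ|_{Γ_E} ≅ ρ₁|_{Γ_E}` (Chebotarev + Brauer–Nesbitt,
   `isConjugate_of_satakeFrobCompatibleAt` — re-derived below, together with
   `satakeFrobCompatibleAt_conj`, from `IrreducibleOffSector.*` exactly as in
   `ReciprocityUpToIrreducibility.CorrespondsConj`, so that this file imports the transfer file
   `IrreducibleOffSectorTransfer` directly and not the larger `CorrespondsConj` cone).
2. Clifford, index two (`CharZeroDominance.eq_conj_or_eq_conj_twist` with the `ℓ`-adic quadratic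
   character `χ = χ_{E/F} : Γ_F → {±1} ⊂ ℚ̄_ℓˣ` of `exists_quadChar`): `ρ = g⁻¹ ρ₁ g` or
   `ρ = g⁻¹ (ρ₁ ⊗ χ) g`.
3. First case: `π := π₁` (conjugation invariance `satakeFrobCompatibleAt_conj`).  Second case:
   `π := π₁ ⊗ (ω ∘ det)` for the quadratic Hecke character `ω = ω_{E/F}` — it exists by the tree's
   THEOREM `artinReciprocity_character_holds` (Artin reciprocity for linear characters) applied to
   `quadraticArtinChar F E`, with `ω(ϖ_v) = ε_{E/F}(v)` a.e.
   (`exists_heckeCharacter_quadraticSign_of_reciprocity_quadraticArtinChar`); its Satake parameters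
   are `ε_{E/F}(v) t_{π₁,v}` a.e. (`AutomorphicRepData.eventually_hasSatakeParamAt_twist`), it is
   L-algebraic (`isLAlgebraic_twist`: a finite-order twist preserves the archimedean parameter,
   `AutomorphicRepData.HasArchParameter.twist`), and `ρ₁ ⊗ χ` is unramified with Frobenius
   polynomial `arithFrobPolyOfSatake ι q 1 (ε · α)` at a.e. `v` since `χ(Frob_v) = ε_{E/F}(v)`
   (Frobenius dictionary `quadraticArtinChar_apply_frob_coe`, transported to `ℚ̄_ℓˣ`:
   `coe_quadChar_apply_frob`; `FramedGaloisRep.hasFrobCharpolyAt_twist_of_eq_prod`).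

References: T. Barnet-Lamb, T. Gee, D. Geraghty, R. Taylor, *Potential automorphy and change of
weight*, Ann. of Math. 179 (2014), §5; J. Arthur, L. Clozel, Ann. of Math. Stud. 120 (1989), Ch. 3,
proof of Thm. 3.1 (p. 172) and Thm. 4.2 (d); A. H. Clifford, Ann. of Math. 38 (1937), Thm. 1;
J. Tate, Cassels–Fröhlich Ch. VII §2.3, §5.1.
-/

noncomputable section

set_option linter.dupNamespace false  -- every decl here lives in `Summit.Langlands.Langlands.*` (D-0017 layout)

open scoped MatrixGroups NumberField Classical Polynomial Matrix
open Filter IsDedekindDomain Field Polynomial NumberField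
open Literature.NumberTheory.Automorphic Literature.NumberTheory.GaloisRepresentations
open Summit.Langlands
open Summit.Langlands.Langlands.Cruxes.MuOrdinaryFamilyRT.CharZeroDominance
  (exists_quadChar eq_conj_or_eq_conj_twist)

namespace Summit.Langlands.Langlands.Theorems.ReciprocityTRCM

/-! ## A finite-order twist preserves L-algebraicity -/

section Twist

variable {n : ℕ} {K : Type} [Field K] [NumberField K] {hcpt : isCompact_glFiniteIntegralLevel n K}

/-- **L-algebraicity is preserved by the twist `π ⊗ (χ ∘ det)` by a Hecke character of finite
order**: the twist has the same archimedean (Harish-Chandra) parameter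
(`AutomorphicRepData.HasArchParameter.twist`: `χ ∘ det` is trivial on `exp 𝔤`), hence every
infinity type of `π` is one of `π ⊗ (χ ∘ det)`. [cite: BorelJacquet1979, §4.6] [cite: Clozel1990, §3.3] -/
theorem isLAlgebraic_twist (π : AutomorphicRepData (AutomorphyDatum.gl n K hcpt))
    (χ : HeckeCharacter K) (hχ : χ.IsFiniteOrder) (h : π.IsLAlgebraic) :
    (π.twist χ hχ).IsLAlgebraic := by
  obtain ⟨T, ⟨hwf, hP⟩, hT⟩ := h
  exact ⟨T, ⟨hwf, AutomorphicRepData.HasArchParameter.twist π χ hχ hP⟩, hT⟩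

end Twist

/-! ## The `ℓ`-adic quadratic character of `E/F`: inertia and Frobenius dictionary -/

section QuadChar

variable {F E : Type} [Field F] [NumberField F] [Field E] [NumberField E] [Algebra F E]
  {ℓ : ℕ} [Fact ℓ.Prime]

/-- A character `χ : Γ_F → ℚ̄_ℓˣ` trivial on `Gal(F̄/E)` is trivial on the inertia groups above
every place at which the quadratic Artin character `χ_{E/F}` is unramified (same kernel,
`quadraticArtinChar_apply_eq_one_iff`). [folklore] -/
theorem quadChar_eq_one_of_mem_inertia (h2 : Module.finrank F E = 2)
    {χ : absoluteGaloisGroup F →ₜ* (PadicAlgCl ℓ)ˣ}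
    (hχ₁ : ∀ g ∈ (absGaloisRestrict F E).range, χ g = 1)
    {v : HeightOneSpectrum (𝓞 F)} (hχv : (quadraticArtinChar F E h2).IsUnramifiedAt v)
    {𝔓 : Ideal (absIntegers (𝓞 F) F)} (h𝔓 : 𝔓 ∈ v.primesAbove)
    {σ : absoluteGaloisGroup F} (hσ : σ ∈ 𝔓.inertia (absoluteGaloisGroup F)) : χ σ = 1 :=
  hχ₁ σ ((quadraticArtinChar_apply_eq_one_iff h2 σ).mp (hχv 𝔓 h𝔓 σ hσ))

/-- **Frobenius dictionary for the `ℓ`-adic quadratic character** (Tate, Cassels–Fröhlich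
Ch. VII §2.3, transported from `quadraticArtinChar_apply_frob_coe`): if `χ : Γ_F → ℚ̄_ℓˣ` is `1` on
`Gal(F̄/E)` and `-1` off it, then at a place `v` unramified in `E` with `χ_{E/F}` unramified at
`v`, every arithmetic Frobenius `Φ` above `v` has `χ(Φ) = ι⁻¹(ε_{E/F}(v))` (`quadraticSign`:
`+1` at split, `-1` at inert `v`). [cite: CasselsFrohlichANT1967, Ch. VII §2.3] -/
theorem coe_quadChar_apply_frob (h2 : Module.finrank F E = 2) (ι : PadicAlgCl ℓ ≃+* ℂ)
    {χ : absoluteGaloisGroup F →ₜ* (PadicAlgCl ℓ)ˣ}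
    (hχ₁ : ∀ g ∈ (absGaloisRestrict F E).range, χ g = 1)
    (hχ₂ : ∀ g ∉ (absGaloisRestrict F E).range, χ g = -1)
    {v : HeightOneSpectrum (𝓞 F)} (hvE : Algebra.IsUnramifiedIn (𝓞 E) v.asIdeal)
    (hχv : (quadraticArtinChar F E h2).IsUnramifiedAt v)
    {𝔓 : Ideal (absIntegers (𝓞 F) F)} (h𝔓 : 𝔓 ∈ v.primesAbove) {Φ : absoluteGaloisGroup F}
    (hΦ : IsArithFrobAt (𝓞 F) Φ 𝔓) :
    ((χ Φ : (PadicAlgCl ℓ)ˣ) : PadicAlgCl ℓ) = ι.symm (quadraticSign E v) := by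
  have hfrob := quadraticArtinChar_apply_frob_coe h2 hvE hχv h𝔓 hΦ 0 0
  by_cases hmem : Φ ∈ ((absGaloisRestrict F E).range : Subgroup (absoluteGaloisGroup F))
  · rw [quadraticArtinChar_apply_coe_of_mem h2 hmem] at hfrob
    rw [hχ₁ Φ hmem, ← hfrob, Units.val_one, map_one]
  · rw [quadraticArtinChar_apply_coe_of_not_mem h2 hmem] at hfrob
    rw [hχ₂ Φ hmem, ← hfrob, Units.val_neg, Units.val_one, map_neg, map_one]

end QuadChar

/-! ## Satake–Frobenius bookkeeping of the sign twist (L-normalisation `m = 1`) -/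

section Bookkeeping

variable {ℓ : ℕ} [Fact ℓ.Prime]

/-- `arithFrobPolyOfSatake ι q 1 α = ∏_{b ∈ β} (X - b)` with `β = {ι⁻¹(a⁻¹) : a ∈ α}`
(unfolding, `arithFrobPolyOfSatake_one`). [folklore] -/
theorem arithFrobPolyOfSatake_one_eq_prod_map (ι : PadicAlgCl ℓ ≃+* ℂ) (q : ℕ) (α : Multiset ℂ) :
    arithFrobPolyOfSatake ι q 1 α = ((α.map fun a => ι.symm a⁻¹).map fun b => X - C b).prod := by
  rw [arithFrobPolyOfSatake_one, Multiset.map_map]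
  rfl

/-- **Twisting the Satake parameter by a sign rescales the predicted Frobenius roots by the
sign**: for `ε² = 1`, the roots of `arithFrobPolyOfSatake ι q 1 (ε · α)` are `ι⁻¹(ε) · ι⁻¹(a⁻¹)`,
`a ∈ α` (`(ε a)⁻¹ = ε a⁻¹`). [folklore] -/
theorem arithFrobPolyOfSatake_one_map_mul (ι : PadicAlgCl ℓ ≃+* ℂ) (q : ℕ) (α : Multiset ℂ)
    {ε : ℂ} (hε : ε * ε = 1) :
    arithFrobPolyOfSatake ι q 1 (α.map (ε * ·)) =
      ((α.map fun a => ι.symm a⁻¹).map fun b => X - C (ι.symm ε * b)).prod := by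
  rw [arithFrobPolyOfSatake_one, Multiset.map_map, Multiset.map_map]
  congr 1
  refine Multiset.map_congr rfl fun a _ => ?_
  have hε' : ε⁻¹ = ε := inv_eq_of_mul_eq_one_right hε
  simp only [Function.comp_apply, mul_inv, hε', map_mul]

end Bookkeeping

/-! ## Compatibility of the twisted pair `(π₁ ⊗ η_{E/F}, ρ₁ ⊗ χ_{E/F})` at a good place -/

section TwistCompat

variable {F E : Type} [Field F] [NumberField F] [Field E] [NumberField E] [Algebra F E]
  {n : ℕ} {hF : isCompact_glFiniteIntegralLevel n F} {ℓ : ℕ} [Fact ℓ.Prime]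

/-- **The twisted pair is Satake–Frobenius compatible at a good place** (Arthur–Clozel Ch. 3,
p. 172: `t_{π ⊗ η,v} = ε_{E/F}(v) t_{π,v}`; Frobenius dictionary `χ_{E/F}(Frob_v) = ε_{E/F}(v)`).
At a place `v` unramified in `E` where `χ_{E/F}` is unramified: if `π` and `ρ` are compatible at
`v` (summit predicate, L-normalisation) and `π'` has Satake parameter `ε_{E/F}(v) · α` for every
Satake parameter `α` of `π` at `v`, then `π'` and `ρ ⊗ χ` are compatible at `v`, for the `ℓ`-adic
quadratic character `χ` (`1` on `Gal(F̄/E)`, `-1` off it): `ρ ⊗ χ` is unramified at `v`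
(`FramedGaloisRep.isUnramifiedAt_twist`) and its Frobenius roots are those of `ρ` rescaled by
`ι⁻¹(ε_{E/F}(v))` (`FramedGaloisRep.hasFrobCharpolyAt_twist_of_eq_prod`).
[cite: ArthurClozelAMS120, Ch. 3, proof of Thm. 3.1 (p. 172)] -/
theorem satakeFrobCompatibleAt_twist_quadChar (h2 : Module.finrank F E = 2)
    (ι : PadicAlgCl ℓ ≃+* ℂ) {π π' : AutomorphicRepData (AutomorphyDatum.gl n F hF)}
    {ρ : FramedGaloisRep F (PadicAlgCl ℓ) n} {χ : absoluteGaloisGroup F →ₜ* (PadicAlgCl ℓ)ˣ}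
    (hχ₁ : ∀ g ∈ (absGaloisRestrict F E).range, χ g = 1)
    (hχ₂ : ∀ g ∉ (absGaloisRestrict F E).range, χ g = -1)
    {v : HeightOneSpectrum (𝓞 F)} (hvE : Algebra.IsUnramifiedIn (𝓞 E) v.asIdeal)
    (hχv : (quadraticArtinChar F E h2).IsUnramifiedAt v)
    (htw : ∀ α : Multiset ℂ, π.HasSatakeParamAt v α →
      π'.HasSatakeParamAt v (α.map (quadraticSign E v * ·)))
    (h : SatakeFrobCompatibleAt ι π ρ v) :
    SatakeFrobCompatibleAt ι π' (ρ.twist χ) v := by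
  obtain ⟨α, hα, hur, hcp⟩ := h
  refine ⟨α.map (quadraticSign E v * ·), htw α hα,
    FramedGaloisRep.isUnramifiedAt_twist hur fun 𝔓 h𝔓 σ hσ =>
      quadChar_eq_one_of_mem_inertia h2 hχ₁ hχv h𝔓 hσ, ?_⟩
  rw [arithFrobPolyOfSatake_one_map_mul ι _ α (quadraticSign_mul_self (E := E) v)]
  rw [arithFrobPolyOfSatake_one_eq_prod_map] at hcp
  exact FramedGaloisRep.hasFrobCharpolyAt_twist_of_eq_prod hcp fun 𝔓 h𝔓 σ hσ =>
    coe_quadChar_apply_frob h2 ι hχ₁ hχ₂ hvE hχv h𝔓 hσ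

end TwistCompat

/-! ## Change of frame: compatibility is conjugation invariant; irreducible avatars are conjugate

Private copies of `ReciprocityUpToIrreducibility.satakeFrobCompatibleAt_conj` and
`ReciprocityUpToIrreducibility.isConjugate_of_satakeFrobCompatibleAt` (file
`IrreducibilityBySelfDualityReciprocityUpToIrreducibilityCorrespondsConj`), with the same two-line
proofs from `IrreducibleOffSector.*`, so that this file's import cone is that of
`IrreducibleOffSectorTransfer`. -/

section Frame

variable {K : Type} [Field K] [NumberField K] {n : ℕ} {hcpt : isCompact_glFiniteIntegralLevel n K}
  {ℓ : ℕ} [Fact ℓ.Prime]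

-- adapted from `ReciprocityUpToIrreducibility.satakeFrobCompatibleAt_conj` (CorrespondsConj)
/-- Satake–Frobenius compatibility at `v` is invariant under `ρ ↦ P ρ P⁻¹` (unramifiedness and the
characteristic polynomial of Frobenius are). [cite: SerreAbelianLadic1968, Ch. I §2.3] -/
private theorem satakeFrobCompatibleAt_conj (ι : PadicAlgCl ℓ ≃+* ℂ)
    (π : AutomorphicRepData (AutomorphyDatum.gl n K hcpt)) (P : GL (Fin n) (PadicAlgCl ℓ))
    {ρ : FramedGaloisRep K (PadicAlgCl ℓ) n} {v : HeightOneSpectrum (𝓞 K)}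
    (h : SatakeFrobCompatibleAt ι π ρ v) : SatakeFrobCompatibleAt ι π (FramedRep.conj P ρ) v := by
  obtain ⟨α, hα, hur, hcp⟩ := h
  exact ⟨α, hα, (FramedGaloisRep.isUnramifiedAt_conj_iff v P ρ).mpr hur, fun 𝔓 h𝔓 σ hσ =>
    (IrreducibleOffSector.charpoly_conj P ρ σ).trans (hcp 𝔓 h𝔓 σ hσ)⟩

-- adapted from `ReciprocityUpToIrreducibility.isConjugate_of_satakeFrobCompatibleAt` (CorrespondsConj)
/-- **Two avatars of one `π`, one of them irreducible, are conjugate** (Chebotarev + Brauer–Nesbitt: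
equal Frobenius characteristic polynomials a.e. by uniqueness of Satake parameters, irreducibility
transfers, semisimple representations with the same traces are equivalent, equivalent framed
representations are conjugate). [cite: DeligneSerreASENS1974, Lemme 3.2] -/
private theorem isConjugate_of_satakeFrobCompatibleAt
    (π : AutomorphicRepData (AutomorphyDatum.gl n K hcpt))
    (ι : PadicAlgCl ℓ ≃+* ℂ) {ρ₀ ρ : FramedGaloisRep K (PadicAlgCl ℓ) n}
    (hirr₀ : ρ₀.toGaloisRep.IsIrreducible)
    (h₀ : ∀ᶠ v : HeightOneSpectrum (𝓞 K) in cofinite, SatakeFrobCompatibleAt ι π ρ₀ v)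
    (h : ∀ᶠ v : HeightOneSpectrum (𝓞 K) in cofinite, SatakeFrobCompatibleAt ι π ρ v) :
    IsConjugate ρ₀ ρ := by
  have hirr : ρ.toGaloisRep.IsIrreducible :=
    IrreducibleOffSector.isIrreducible_of_satakeFrobCompatible π ι hirr₀ h₀ h
  obtain ⟨e⟩ := FramedGaloisRep.nonempty_equiv_of_hasFrobCharpolyAt_eventually
    chebotarev_artinRep_holds ρ₀ ρ (IrreducibleOffSector.isSemisimple_of_isIrreducible ρ₀ hirr₀)
    (IrreducibleOffSector.isSemisimple_of_isIrreducible ρ hirr)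
    (IrreducibleOffSector.eventually_hasFrobCharpolyAt_common π ι h₀ h)
  obtain ⟨P, hP⟩ := FramedRep.exists_eq_conj_of_equiv ρ₀ ρ e
  exact ⟨P, hP.symm⟩

end Frame

/-! ## Assembly: twist matching after quadratic descent -/

section Main

variable {F E : Type} [Field F] [NumberField F] [Field E] [NumberField E] [Algebra F E]
  {n : ℕ} {hF : isCompact_glFiniteIntegralLevel n F} {hE : isCompact_glFiniteIntegralLevel n E}
  {ℓ : ℕ} [Fact ℓ.Prime]

/-- **Twist matching after quadratic descent** (BLGGT §5; Arthur–Clozel Ch. 3, proof of Thm. 3.1).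
`E/F` quadratic, `R` reciprocity data over `F` with direction (A) in rank `n`, `ρ : Γ_F → GL_n(ℚ̄_ℓ)`
with `ρ|_{Γ_E}` irreducible, `P` automorphic on `GL_n(𝔸_E)` a.e. compatible with `ρ|_{Γ_E}`, and
`π₁` cuspidal L-algebraic on `GL_n(𝔸_F)` with `P` a weak base change of `π₁`.  Then an L-algebraic
cuspidal `π ∈ {π₁, π₁ ⊗ ω_{E/F}}` is Satake–Frobenius compatible with `ρ` almost everywhere:
(A) gives `ρ₁ ↔ π₁`; `ρ|_{Γ_E} ≅ ρ₁|_{Γ_E}` by Chebotarev rigidity over `E`; Clifford (index `2`)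
gives `ρ ∈ {ρ₁, ρ₁ ⊗ χ_{E/F}}` up to conjugation (rank `0` being trivial); in the twisted case the
quadratic Hecke character `ω_{E/F}` (Artin reciprocity for `χ_{E/F}`, a theorem of the tree)
provides `π₁ ⊗ ω_{E/F}`, L-algebraic with Satake parameters `ε_{E/F}(v) t_{π₁,v}`, matching
`ρ₁ ⊗ χ_{E/F}` by the Frobenius dictionary; compatibility is conjugation invariant.
[cite: BarnetlambEtAl2014, §5] [cite: ArthurClozelAMS120, Ch. 3, proof of Thm. 3.1 (p. 172)] -/
theorem exists_isLAlgebraic_satakeFrobCompatibleAt_of_quadraticDescent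
    (h2 : Module.finrank F E = 2) (R : ReciprocityData F) (hA : AutomorphicToGalois n R hF)
    (ι : PadicAlgCl ℓ ≃+* ℂ) (ρ : FramedGaloisRep F (PadicAlgCl ℓ) n)
    (hirr : (ρ.restrictField E).toGaloisRep.IsIrreducible)
    (P : AutomorphicRepData (AutomorphyDatum.gl n E hE)) (π₁ : CuspidalAutomorphicRepData n F hF)
    (hL : π₁.1.IsLAlgebraic) (hBC : IsWeakBaseChangeLiftAE π₁.1 P)
    (hP : ∀ᶠ w : HeightOneSpectrum (𝓞 E) in cofinite,
      SatakeFrobCompatibleAt ι P (ρ.restrictField E) w) :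
    ∃ π : CuspidalAutomorphicRepData n F hF, π.1.IsLAlgebraic ∧
      ∀ᶠ v : HeightOneSpectrum (𝓞 F) in cofinite, SatakeFrobCompatibleAt ι π.1 ρ v := by
  -- (A) over `F`: `ρ₁ ↔ π₁`; restriction along the base change; Chebotarev rigidity over `E`
  obtain ⟨ρ₁, -, -, hcorr₁, -⟩ := hA π₁ hL ℓ ι
  have h₁E : ∀ᶠ w : HeightOneSpectrum (𝓞 E) in cofinite,
      SatakeFrobCompatibleAt ι P (ρ₁.restrictField E) w :=
    eventually_satakeFrobCompatible_restrictField_of_isWeakBaseChangeLiftAE ι 1 π₁.1 P hBC ρ₁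
      hcorr₁.1
  obtain ⟨g, hg⟩ : IsConjugate (ρ.restrictField E) (ρ₁.restrictField E) :=
    isConjugate_of_satakeFrobCompatibleAt P ι hirr hP h₁E
  -- rank zero: all framed representations into `GL_0` coincide
  rcases Nat.eq_zero_or_pos n with rfl | hn
  · have hρ : ρ = ρ₁ := ContinuousMonoidHom.ext fun σ => Subsingleton.elim _ _
    refine ⟨π₁, hL, ?_⟩
    rw [hρ]
    exact hcorr₁.1
  haveI : NeZero n := ⟨hn.ne'⟩
  -- Clifford theory in index two, with the `ℓ`-adic quadratic character `χ = χ_{E/F}`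
  obtain ⟨χ, hχ₁, hχ₂⟩ := exists_quadChar (A := PadicAlgCl ℓ) (L := F) (E := E) h2
  have hirr' : (ρ.restrictField E).IsIrreducible :=
    (FramedRep.isIrreducible_toContinuousRep_iff _).mp hirr
  rcases eq_conj_or_eq_conj_twist h2 ρ ρ₁ hirr' g hg.symm χ hχ₁ hχ₂ with h | h
  · -- `ρ = g⁻¹ ρ₁ g`: take `π := π₁`
    refine ⟨π₁, hL, ?_⟩
    rw [h]
    exact hcorr₁.1.mono fun v hv => satakeFrobCompatibleAt_conj ι π₁.1 g⁻¹ hv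
  · -- `ρ = g⁻¹ (ρ₁ ⊗ χ_{E/F}) g`: take `π := π₁ ⊗ ω_{E/F}`
    obtain ⟨ω, hωfin, hω⟩ :=
      exists_heckeCharacter_quadraticSign_of_reciprocity_quadraticArtinChar h2
        (artinReciprocity_character_holds F (quadraticArtinChar F E h2))
    refine ⟨π₁.twist ω hωfin, isLAlgebraic_twist π₁.1 ω hωfin hL, ?_⟩
    rw [h, CuspidalAutomorphicRepData.twist_val]
    have hunrE : ∀ᶠ v : HeightOneSpectrum (𝓞 F) in cofinite,
        Algebra.IsUnramifiedIn (𝓞 E) v.asIdeal := by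
      rw [eventually_cofinite]
      exact finite_setOf_not_isUnramifiedIn F E
    filter_upwards [hcorr₁.1, π₁.1.eventually_hasSatakeParamAt_twist hωfin, hω,
      eventually_isUnramifiedAt_quadraticArtinChar h2, hunrE] with v hv htw hωv hχv hvE
    refine satakeFrobCompatibleAt_conj ι _ g⁻¹ ?_
    refine satakeFrobCompatibleAt_twist_quadChar h2 ι hχ₁ hχ₂ hvE hχv (fun α hα => ?_) hv
    rw [← hωv.2]
    exact htw α hα

end Main

/-! ## Registered sub-goal form (crux stmt-Langlands-1093, line `pieces`, stub 5A2) -/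

/-- **Registered stub `stub_twistMatchingOfQuadraticDescent` of line `pieces` (crux
stmt-Langlands-1093), verbatim signature**: after L-algebraic quadratic descent `P ↦ π₁` along a
Galois quadratic `E/F`, with (A) over `F` in rank `n`, `ρ|_{Γ_E}` irreducible and a.e. compatible
with the cuspidal `P`, the representation `ρ` itself is weakly automorphic over `F`: some
L-algebraic cuspidal `π` (`π₁` or `π₁ ⊗ ω_{E/F}`) is Satake–Frobenius compatible with `ρ` almost
everywhere (`exists_isLAlgebraic_satakeFrobCompatibleAt_of_quadraticDescent`).
[cite: BarnetlambEtAl2014, §5] [cite: ArthurClozelAMS120, Ch. 3, proof of Thm. 3.1 (p. 172)] -/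
theorem stub_twistMatchingOfQuadraticDescent : ∀ (n : ℕ) (F E : Type) [Field F] [NumberField F] [Field E] [NumberField E] [Algebra F E] [IsGalois F E], Module.finrank F E = 2 → ∀ (R : ReciprocityData F) (hF : Literature.NumberTheory.Automorphic.isCompact_glFiniteIntegralLevel n F) (hE : Literature.NumberTheory.Automorphic.isCompact_glFiniteIntegralLevel n E), AutomorphicToGalois n R hF → ∀ (ℓ : ℕ) [Fact ℓ.Prime] (ι : PadicAlgCl ℓ ≃+* ℂ) (ρ : Literature.NumberTheory.GaloisRepresentations.FramedGaloisRep F (PadicAlgCl ℓ) n), (ρ.restrictField E).toGaloisRep.IsIrreducible → ∀ (P : Literature.NumberTheory.Automorphic.CuspidalAutomorphicRepData n E hE) (π₁ : Literature.NumberTheory.Automorphic.CuspidalAutomorphicRepData n F hF), π₁.1.IsLAlgebraic → Literature.NumberTheory.Automorphic.IsWeakBaseChangeLiftAE π₁.1 P.1 → (∀ᶠ w : IsDedekindDomain.HeightOneSpectrum (NumberField.RingOfIntegers E) in Filter.cofinite, SatakeFrobCompatibleAt ι P.1 (ρ.restrictField E) w) → ∃ π : Literature.NumberTheory.Automorphic.CuspidalAutomorphicRepData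 n F hF, π.1.IsLAlgebraic ∧ ∀ᶠ v : IsDedekindDomain.HeightOneSpectrum (NumberField.RingOfIntegers F) in Filter.cofinite, SatakeFrobCompatibleAt ι π.1 ρ v := by
  intro n F E _ _ _ _ _ _ h2 R hF hE hA ℓ _ ι ρ hirr P π₁ hL hBC hP
  exact exists_isLAlgebraic_satakeFrobCompatibleAt_of_quadraticDescent h2 R hA ι ρ hirr P.1 π₁
    hL hBC hP

end Summit.Langlands.Langlands.Theorems.ReciprocityTRCM

end
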